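import Literature.Geometry.Riemannian.RicciFlowUniformComparison
import Literature.Geometry.Riemannian.CutLocusProofs
import Mathlib.Topology.UniformSpace.UniformConvergence
import HarnessLib

/-!
# The distance of a Ricci flow on a closed manifold varies Lipschitz-continuously in time;
# `(x, y, t) ↦ d_t(x, y)` is jointly continuous and `d_r² → d_t²` uniformly (Bamler 2020a, §3)

For a Ricci flow `(g, cov)` of Riemannian metrics on `[a, b]` on a closed connected manifold
modelled on `ℝᵐ`: the curvature is bounded on the compact `M × [a, b]`, so `|Ric_t| ≤ K₁ g_t` and
Topping's Lemma 5.3.2 (`IsRicciFlow.metric_equivalence`) gives `e^{−2K₁|t−t′|} g_t ≤ g_{t′} ≤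
e^{2K₁|t−t′|} g_t`, hence `d_{t′} ≤ e^{K₁|t−t′|} d_t` (`edist_le_mul_edist_of_val_le`). We prove:

* `IsRicciFlow.exists_edist_le_exp_mul_edist` — `d_{t′}(x, y) ≤ e^{K₁|t′−t|} d_t(x, y)` for all
  `t, t′ ∈ [a, b]`;
* `IsRicciFlow.exists_abs_dist_sub_dist_le` — with `D(t, x, y) = d_t(x, y)` (real),
  `|D(t′) − D(t)| ≤ B (e^{K₁|t′−t|} − 1)` uniformly in `(x, y)` (`B` a bound for all distances);
* `IsRicciFlow.continuousOn_dist_family` — `(x, y, t) ↦ d_t(x, y)` is continuous on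
  `M × M × [a, b]`;
* `IsRicciFlow.tendstoUniformly_dist_sq_family` — `(x, y) ↦ d_r(x, y)² → d_{t₀}(x, y)²` uniformly as
  `r → t₀` within `[a, b]`.

These are the continuity inputs of the variance `Var_t(μ₁, μ₂) = ∫∫ d_t² dμ₁ dμ₂` along the flow
(Bamler 2020a, §3). Everything is proved; no definitions, no named facts.

## References

* P. Topping, *Lectures on the Ricci flow*, LMS Lecture Note Series 325 (2006), Lemma 5.3.2.
  [Topping2006]
* R. H. Bamler, *Entropy and heat kernel bounds on a Ricci flow background*, arXiv:2008.07093
  (2020), §3. [Bamler2020Entropy]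
-/

noncomputable section

open Bundle Set Function Filter Manifold MeasureTheory Measure TopologicalSpace Module
open scoped Manifold ContDiff Topology ENNReal NNReal

namespace Literature.Geometry.Riemannian

open Lorentzian Lorentzian.PseudoRiemannianMetric

section DistanceContinuity

variable {m : ℕ} {H : Type*} [TopologicalSpace H]
  {I : ModelWithCorners ℝ (EuclideanSpace ℝ (Fin m)) H}
  {M : Type*} [TopologicalSpace M] [ChartedSpace H M] [IsManifold I ∞ M]
  [T2Space M] [CompactSpace M] [PreconnectedSpace M]
  {g : ℝ → PseudoRiemannianMetric I ∞ (EuclideanSpace ℝ (Fin m)) (TangentSpace I : M → Type _)}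
  {cov : ℝ → CovariantDerivative I (EuclideanSpace ℝ (Fin m)) (TangentSpace I : M → Type _)}

omit [CompactSpace M] [PreconnectedSpace M] [T2Space M] in
/-- **Metric comparison between two times of a Ricci flow** (Topping 2006, Lemma 5.3.2, applied to
the flow restarted at the earlier time): if `|Ric_s(X,X)| ≤ K₁ g_s(X,X)` for `s ∈ [a, b]`, then for
`t ≤ t′` in `[a, b]`, `g_{t′}(X, X) ≤ e^{2K₁(t′−t)} g_t(X, X)` and `g_t(X, X) ≤ e^{2K₁(t′−t)} g_{t′}(X, X)`.
[cite: Topping2006, Lemma 5.3.2] -/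
theorem IsRicciFlow.val_le_exp_mul_val_of_le {a b : ℝ} (hflow : IsRicciFlow g cov (Icc a b))
    (hR : ∀ s ∈ Icc a b, (g s).IsRiemannian) {K₁ : ℝ}
    (hRic : ∀ s ∈ Icc a b, ∀ (x : M) (X : TangentSpace I x),
      |(cov s).ricci x X X| ≤ K₁ * (g s).val x X X)
    {t t' : ℝ} (ht : t ∈ Icc a b) (ht' : t' ∈ Icc a b) (htt' : t ≤ t') (x : M) (X : TangentSpace I x) :
    (g t').val x X X ≤ Real.exp (2 * K₁ * (t' - t)) * (g t).val x X X ∧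
      (g t).val x X X ≤ Real.exp (2 * K₁ * (t' - t)) * (g t').val x X X := by
  -- the flow restarted at time `t`, on `[0, t' - t]`
  have hflow₁ : IsRicciFlow (fun r ↦ g (r + t)) (fun r ↦ cov (r + t)) (Icc 0 (t' - t)) := by
    refine (hflow.comp_add_const t).mono fun r hr ↦ ?_
    exact ⟨by linarith [hr.1, ht.1], by linarith [hr.2, ht'.2]⟩
  have hR₁ : ∀ r ∈ Icc (0 : ℝ) (t' - t), (g (r + t)).IsRiemannian := fun r hr ↦
    hR _ ⟨by linarith [hr.1, ht.1], by linarith [hr.2, ht'.2]⟩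
  have hRic₁ : ∀ r ∈ Icc (0 : ℝ) (t' - t), ∀ (x : M) (X : TangentSpace I x),
      |(cov (r + t)).ricci x X X| ≤ K₁ * (g (r + t)).val x X X := fun r hr x X ↦
    hRic _ ⟨by linarith [hr.1, ht.1], by linarith [hr.2, ht'.2]⟩ x X
  have key := hflow₁.metric_equivalence hR₁ hRic₁ (t' - t) ⟨sub_nonneg.2 htt', le_rfl⟩ x X
  simp only [sub_add_cancel, zero_add] at key
  obtain ⟨h1, h2⟩ := key
  refine ⟨h2, ?_⟩
  -- from `e^{-2K₁(t'-t)} g_t ≤ g_{t'}`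
  have hexp : 0 < Real.exp (2 * K₁ * (t' - t)) := Real.exp_pos _
  have := mul_le_mul_of_nonneg_left h1 hexp.le
  rwa [← mul_assoc, ← Real.exp_add, show 2 * K₁ * (t' - t) + -(2 * K₁ * (t' - t)) = 0 by ring,
    Real.exp_zero, one_mul] at this

omit [PreconnectedSpace M] in
/-- **`d_{t′} ≤ e^{K₁|t′−t|} d_t` along a Ricci flow on a closed manifold**: for a Ricci flow of
Riemannian metrics on `[a, b]` there is `K₁ ≥ 0` with `d_{t′}(x, y) ≤ e^{K₁|t′−t|} d_t(x, y)` for all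
`t, t′ ∈ [a, b]`, `x, y` (curvature bound on the compact slab, `val_le_exp_mul_val_of_le`, and
`edist_le_mul_edist_of_val_le`). [cite: Topping2006, Lemma 5.3.2] -/
theorem IsRicciFlow.exists_edist_le_exp_mul_edist {a b : ℝ} (hflow : IsRicciFlow g cov (Icc a b))
    (hR' : ∀ s, (g s).IsRiemannian) :
    ∃ K₁ : ℝ, 0 ≤ K₁ ∧ ∀ t ∈ Icc a b, ∀ t' ∈ Icc a b, ∀ x y : M,
      (g t').edist (hR' t') x y ≤
        ENNReal.ofReal (Real.exp (K₁ * |t' - t|)) * (g t).edist (hR' t) x y := by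
  have hR : ∀ s ∈ Icc a b, (g s).IsRiemannian := fun s _ ↦ hR' s
  obtain ⟨K₀, hK₀⟩ := hflow.smooth.exists_curvatureBoundedBy_of_isCompact hflow.isLeviCivita
    isCompact_Icc subset_rfl hR
  set K : ℝ := max K₀ 0 with hKdef
  have hK : ∀ t ∈ Icc a b, CurvatureBoundedBy (g t) (cov t) K := fun t ht ↦
    (hK₀ t ht).mono (le_max_left _ _)
  set K₁ : ℝ := finrank ℝ (EuclideanSpace ℝ (Fin m)) * K with hK₁def
  have hK₁ : 0 ≤ K₁ := by
    have : 0 ≤ K := le_max_right _ _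
    positivity
  have hRic : ∀ s ∈ Icc a b, ∀ (x : M) (X : TangentSpace I x),
      |(cov s).ricci x X X| ≤ K₁ * (g s).val x X X := fun s hs x X ↦ (hK s hs).abs_ricci_le (hR s hs) x X
  refine ⟨K₁, hK₁, fun t ht t' ht' x y ↦ ?_⟩
  have hc : 0 < Real.exp (2 * K₁ * |t' - t|) := Real.exp_pos _
  have hsqrt : Real.sqrt (Real.exp (2 * K₁ * |t' - t|)) = Real.exp (K₁ * |t' - t|) := by
    rw [show 2 * K₁ * |t' - t| = K₁ * |t' - t| + K₁ * |t' - t| by ring, Real.exp_add,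
      Real.sqrt_mul_self (Real.exp_pos _).le]
  -- the pointwise comparison `g_{t'} ≤ e^{2K₁|t'-t|} g_t`
  have hcomp : ∀ (z : M) (X : TangentSpace I z),
      (g t').val z X X ≤ Real.exp (2 * K₁ * |t' - t|) * (g t).val z X X := by
    intro z X
    rcases le_total t t' with h | h
    · rw [abs_of_nonneg (sub_nonneg.2 h)]
      exact (hflow.val_le_exp_mul_val_of_le hR hRic ht ht' h z X).1
    · rw [abs_of_nonpos (sub_nonpos.2 h), show 2 * K₁ * -(t' - t) = 2 * K₁ * (t - t') by ring]
      exact (hflow.val_le_exp_mul_val_of_le hR hRic ht' ht h z X).2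
  have key := edist_le_mul_edist_of_val_le (hR' t) (hR' t') hc hcomp x y
  rwa [hsqrt] at key

/-- **A uniform bound for all distances along the flow**: `d_t(x, y) ≤ B` (as a real number) for
`t ∈ [a, b]`, `x, y ∈ M` (compactness at one time and the comparison between times).
[cite: Topping2006, Lemma 5.3.2] -/
theorem IsRicciFlow.exists_edist_toReal_le {a b : ℝ} (hab : a ≤ b) (hflow : IsRicciFlow g cov (Icc a b))
    (hR' : ∀ s, (g s).IsRiemannian) :
    ∃ B : ℝ, 0 ≤ B ∧ ∀ t ∈ Icc a b, ∀ x y : M, ((g t).edist (hR' t) x y).toReal ≤ B := by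
  have ha : a ∈ Icc a b := left_mem_Icc.2 hab
  obtain ⟨K₁, hK₁, hcmp⟩ := hflow.exists_edist_le_exp_mul_edist hR'
  -- distances at time `a` are bounded
  have hca : Continuous fun p : M × M ↦ ((g a).edist (hR' a) p.1 p.2).toReal :=
    ENNReal.continuousOn_toReal.comp_continuous (PseudoRiemannianMetric.continuous_edist (hR' a))
      fun p ↦ PseudoRiemannianMetric.edist_ne_top (hR' a) p.1 p.2
  obtain ⟨B₀, hB₀⟩ := isCompact_univ.exists_bound_of_continuousOn hca.continuousOn
  refine ⟨Real.exp (K₁ * (b - a)) * max B₀ 0, by positivity, fun t ht x y ↦ ?_⟩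
  have h1 := hcmp a ha t ht x y
  have hfin : (g a).edist (hR' a) x y ≠ ⊤ := PseudoRiemannianMetric.edist_ne_top (hR' a) x y
  have h2 : ((g t).edist (hR' t) x y).toReal ≤
      Real.exp (K₁ * |t - a|) * ((g a).edist (hR' a) x y).toReal := by
    have := ENNReal.toReal_mono (ENNReal.mul_ne_top ENNReal.ofReal_ne_top hfin) h1
    rwa [ENNReal.toReal_mul, ENNReal.toReal_ofReal (Real.exp_pos _).le] at this
  have h3 : ((g a).edist (hR' a) x y).toReal ≤ max B₀ 0 := by
    have := hB₀ (x, y) (mem_univ _)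
    rw [Real.norm_eq_abs] at this
    exact ((le_abs_self _).trans this).trans (le_max_left _ _)
  have h4 : Real.exp (K₁ * |t - a|) ≤ Real.exp (K₁ * (b - a)) :=
    Real.exp_le_exp.2 (mul_le_mul_of_nonneg_left (by
      rw [abs_of_nonneg (sub_nonneg.2 ht.1)]; linarith [ht.2]) hK₁)
  calc ((g t).edist (hR' t) x y).toReal ≤ Real.exp (K₁ * |t - a|) * ((g a).edist (hR' a) x y).toReal := h2
    _ ≤ Real.exp (K₁ * (b - a)) * max B₀ 0 :=
        mul_le_mul h4 h3 ENNReal.toReal_nonneg (Real.exp_pos _).le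

/-- **The distance is Lipschitz-like in time, uniformly in space**: there are `K₁, B ≥ 0` with
`|d_{t′}(x, y) − d_t(x, y)| ≤ B (e^{K₁|t′−t|} − 1)` for all `t, t′ ∈ [a, b]`, `x, y`.
[cite: Topping2006, Lemma 5.3.2] -/
theorem IsRicciFlow.exists_abs_edist_toReal_sub_le {a b : ℝ} (hab : a ≤ b)
    (hflow : IsRicciFlow g cov (Icc a b)) (hR' : ∀ s, (g s).IsRiemannian) :
    ∃ K₁ B : ℝ, 0 ≤ K₁ ∧ 0 ≤ B ∧ ∀ t ∈ Icc a b, ∀ t' ∈ Icc a b, ∀ x y : M,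
      |((g t').edist (hR' t') x y).toReal - ((g t).edist (hR' t) x y).toReal| ≤
        B * (Real.exp (K₁ * |t' - t|) - 1) := by
  obtain ⟨K₁, hK₁, hcmp⟩ := hflow.exists_edist_le_exp_mul_edist hR'
  obtain ⟨B, hB, hbd⟩ := hflow.exists_edist_toReal_le hab hR'
  refine ⟨K₁, B, hK₁, hB, fun t ht t' ht' x y ↦ ?_⟩
  have hfin : ∀ s, (g s).edist (hR' s) x y ≠ ⊤ := fun s ↦ PseudoRiemannianMetric.edist_ne_top (hR' s) x y
  have hreal : ∀ {s s' : ℝ}, s ∈ Icc a b → s' ∈ Icc a b →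
      ((g s').edist (hR' s') x y).toReal ≤ Real.exp (K₁ * |s' - s|) * ((g s).edist (hR' s) x y).toReal := by
    intro s s' hs hs'
    have := ENNReal.toReal_mono (ENNReal.mul_ne_top ENNReal.ofReal_ne_top (hfin s)) (hcmp s hs s' hs' x y)
    rwa [ENNReal.toReal_mul, ENNReal.toReal_ofReal (Real.exp_pos _).le] at this
  have h1 := hreal ht ht'
  have h2 := hreal ht' ht
  rw [abs_sub_comm] at h2
  have hE : 1 ≤ Real.exp (K₁ * |t' - t|) := Real.one_le_exp (by positivity)
  have hd := hbd t ht x y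
  have hd' := hbd t' ht' x y
  have h0 : 0 ≤ ((g t).edist (hR' t) x y).toReal := ENNReal.toReal_nonneg
  have h0' : 0 ≤ ((g t').edist (hR' t') x y).toReal := ENNReal.toReal_nonneg
  rw [abs_le]
  constructor <;> nlinarith

/-- **`(x, y, t) ↦ d_t(x, y)` is jointly continuous on `M × M × [a, b]`** along a Ricci flow on a
closed connected manifold (continuity in `(x, y)` at fixed `t`, `continuous_edist`, and the
uniform estimate in `t`). [cite: Topping2006, Lemma 5.3.2] -/
theorem IsRicciFlow.continuousOn_edist_toReal_family {a b : ℝ} (hab : a ≤ b)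
    (hflow : IsRicciFlow g cov (Icc a b)) (hR' : ∀ s, (g s).IsRiemannian) :
    ContinuousOn (fun p : M × M × ℝ ↦ ((g p.2.2).edist (hR' p.2.2) p.1 p.2.1).toReal)
      (univ ×ˢ univ ×ˢ Icc a b) := by
  obtain ⟨K₁, B, hK₁, hB, hlip⟩ := hflow.exists_abs_edist_toReal_sub_le hab hR'
  rintro ⟨x₀, y₀, t₀⟩ ⟨-, -, ht₀⟩
  rw [ContinuousWithinAt, Metric.tendsto_nhds]
  intro ε hε
  -- continuity in `(x, y)` at the fixed time `t₀`
  have hc₀ : Continuous fun p : M × M ↦ ((g t₀).edist (hR' t₀) p.1 p.2).toReal :=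
    ENNReal.continuousOn_toReal.comp_continuous (PseudoRiemannianMetric.continuous_edist (hR' t₀))
      fun p ↦ PseudoRiemannianMetric.edist_ne_top (hR' t₀) p.1 p.2
  have hA : ∀ᶠ p in 𝓝[univ ×ˢ univ ×ˢ Icc a b] ((x₀, y₀, t₀) : M × M × ℝ),
      |((g t₀).edist (hR' t₀) p.1 p.2.1).toReal - ((g t₀).edist (hR' t₀) x₀ y₀).toReal| < ε / 2 := by
    have h1 : Tendsto (fun p : M × M × ℝ ↦ ((g t₀).edist (hR' t₀) p.1 p.2.1).toReal) (𝓝 (x₀, y₀, t₀))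
        (𝓝 ((g t₀).edist (hR' t₀) x₀ y₀).toReal) :=
      (hc₀.comp (continuous_fst.prodMk (continuous_fst.comp continuous_snd))).tendsto (x₀, y₀, t₀)
    rw [Metric.tendsto_nhds] at h1
    exact eventually_nhdsWithin_of_eventually_nhds (by simpa only [Real.dist_eq] using h1 (ε / 2) (half_pos hε))
  -- continuity in `t`: `B (e^{K₁|t - t₀|} - 1) < ε/2` near `t₀`
  have hB' : ∀ᶠ p in 𝓝[univ ×ˢ univ ×ˢ Icc a b] ((x₀, y₀, t₀) : M × M × ℝ),
      B * (Real.exp (K₁ * |p.2.2 - t₀|) - 1) < ε / 2 ∧ p.2.2 ∈ Icc a b := by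
    have hg : Tendsto (fun t : ℝ ↦ B * (Real.exp (K₁ * |t - t₀|) - 1)) (𝓝 t₀) (𝓝 (B * (Real.exp (K₁ * |t₀ - t₀|) - 1))) :=
      ((continuous_const.mul ((Real.continuous_exp.comp (continuous_const.mul
        ((continuous_id.sub continuous_const).abs))).sub continuous_const)).tendsto t₀)
    rw [sub_self, abs_zero, mul_zero, Real.exp_zero, sub_self, mul_zero] at hg
    have h1 : ∀ᶠ t in 𝓝 t₀, B * (Real.exp (K₁ * |t - t₀|) - 1) < ε / 2 :=
      hg (Iio_mem_nhds (half_pos hε))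
    have h2 : ∀ᶠ p in 𝓝 ((x₀, y₀, t₀) : M × M × ℝ), B * (Real.exp (K₁ * |p.2.2 - t₀|) - 1) < ε / 2 :=
      ((continuous_snd.comp continuous_snd : Continuous fun p : M × M × ℝ ↦ p.2.2).tendsto
        ((x₀, y₀, t₀) : M × M × ℝ)).eventually h1
    filter_upwards [eventually_nhdsWithin_of_eventually_nhds h2, self_mem_nhdsWithin] with p hp hq
    exact ⟨hp, hq.2.2⟩
  filter_upwards [hA, hB'] with p hp hq
  obtain ⟨x, y, t⟩ := p
  obtain ⟨hq1, ht⟩ := hq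
  rw [Real.dist_eq]
  have h1 := hlip t₀ ht₀ t ht x y
  calc |((g t).edist (hR' t) x y).toReal - ((g t₀).edist (hR' t₀) x₀ y₀).toReal|
      ≤ |((g t).edist (hR' t) x y).toReal - ((g t₀).edist (hR' t₀) x y).toReal| +
          |((g t₀).edist (hR' t₀) x y).toReal - ((g t₀).edist (hR' t₀) x₀ y₀).toReal| := abs_sub_le _ _ _
    _ < ε := by linarith

/-- **`d_r² → d_{t₀}²` uniformly on `M × M` as `r → t₀` within `[a, b]`** along a Ricci flow on a
closed connected manifold. [cite: Topping2006, Lemma 5.3.2] -/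
theorem IsRicciFlow.tendstoUniformly_edist_toReal_sq {a b : ℝ} (hab : a ≤ b)
    (hflow : IsRicciFlow g cov (Icc a b)) (hR' : ∀ s, (g s).IsRiemannian) {t₀ : ℝ} (ht₀ : t₀ ∈ Icc a b) :
    TendstoUniformly (fun r (q : M × M) ↦ ((g r).edist (hR' r) q.1 q.2).toReal ^ 2)
      (fun q ↦ ((g t₀).edist (hR' t₀) q.1 q.2).toReal ^ 2) (𝓝[Icc a b] t₀) := by
  obtain ⟨K₁, B, hK₁, hB, hlip⟩ := hflow.exists_abs_edist_toReal_sub_le hab hR'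
  obtain ⟨B', hB', hbd⟩ := hflow.exists_edist_toReal_le hab hR'
  rw [Metric.tendstoUniformly_iff]
  intro ε hε
  -- `2 B' B (e^{K₁|r - t₀|} - 1) < ε` near `t₀`
  have hg : Tendsto (fun r : ℝ ↦ 2 * B' * (B * (Real.exp (K₁ * |r - t₀|) - 1))) (𝓝 t₀)
      (𝓝 (2 * B' * (B * (Real.exp (K₁ * |t₀ - t₀|) - 1)))) :=
    ((continuous_const.mul (continuous_const.mul ((Real.continuous_exp.comp (continuous_const.mul
      ((continuous_id.sub continuous_const).abs))).sub continuous_const))).tendsto t₀)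
  rw [sub_self, abs_zero, mul_zero, Real.exp_zero, sub_self, mul_zero, mul_zero] at hg
  have h1 : ∀ᶠ r in 𝓝 t₀, 2 * B' * (B * (Real.exp (K₁ * |r - t₀|) - 1)) < ε := hg (Iio_mem_nhds hε)
  filter_upwards [eventually_nhdsWithin_of_eventually_nhds h1, self_mem_nhdsWithin] with r hr hrI q
  obtain ⟨x, y⟩ := q
  rw [Real.dist_eq]
  have hd := hlip t₀ ht₀ r hrI x y
  have h0 := hbd r hrI x y
  have h0' := hbd t₀ ht₀ x y
  have hn : 0 ≤ ((g r).edist (hR' r) x y).toReal := ENNReal.toReal_nonneg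
  have hn' : 0 ≤ ((g t₀).edist (hR' t₀) x y).toReal := ENNReal.toReal_nonneg
  rw [sq_sub_sq, abs_mul]
  have hsum : |((g t₀).edist (hR' t₀) x y).toReal + ((g r).edist (hR' r) x y).toReal| ≤ 2 * B' := by
    rw [abs_of_nonneg (by positivity)]; linarith
  have hE : 0 ≤ B * (Real.exp (K₁ * |r - t₀|) - 1) := mul_nonneg hB (by linarith [Real.one_le_exp (by positivity : 0 ≤ K₁ * |r - t₀|)])
  rw [abs_sub_comm] at hd
  calc |((g t₀).edist (hR' t₀) x y).toReal + ((g r).edist (hR' r) x y).toReal| *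
        |((g t₀).edist (hR' t₀) x y).toReal - ((g r).edist (hR' r) x y).toReal|
      ≤ 2 * B' * (B * (Real.exp (K₁ * |r - t₀|) - 1)) := mul_le_mul hsum hd (abs_nonneg _) (by positivity)
    _ < ε := hr

end DistanceContinuity

end Literature.Geometry.Riemannian

end
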